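import Summits.ValiantsHypothesis.ValiantsHypothesis.Theorems.GeneratorObstructionsPerGenDegreeSuperQPTwoMonomialsRay

/-!
# Route GeneratorObstructions — K1 `PerGenDegreeSuperQP` (stmt-ValiantsHypothesis-11654),
# line `per-side-atoms`: the ray `j = 2` of `S(per_m)` is hit — the binary Fermat form
# `y^m + w^m = per_m(y·1 + w·C)`

Twentieth support file of the line; the case `r = p = 1` left out of `…TwoMonomials(Ray)`
(whose separating stabilizers need two letters in a block). The binary form `y^m + w^m`
(`m ≥ 2`) is polystable: its diagonal stabilizer `(ζ, 1)`, `ζ` a primitive `m`-th root of unity,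
separates the two letters, and `(1,1) = (1/m)(m,0) + (1/m)(0,m)`; it is `per_m(y·1 + w·C)` (`C` the
cyclic shift; `linSubst_cycleDiag_labels_perFormLex` with constant labels), hence a 2-variable
degeneration of `per_m`, and by the ray criterion **the ray `j = 2` of `S(per_m)` is hit and
carries an atom for every `m ≥ 2`** (`per_ray_two_hit`, `per_exists_ray_atom_two`). With
`…BiCollapsedPermanentRays` and `…TwoMonomialsRay`: every product and every sum of two divisors of
`m` is the length of a hit chamber ray of `S(per_m)`.

(The first-occurrence degree on the ray `2` is the least degree of an `SL₂`-invariant of binary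
`m`-ics not vanishing on some binary degeneration of `per_m` — every binary `m`-ic is one, being a
product of linear forms — i.e. `2` for even `m` and `4` for odd `m ≥ 3`; not formalised here.)

Honest framing: unconditional structure theorems; `stub_atomLate` (`c ≥ 2`), K1 and
`GenFlipThesis` remain OPEN; nothing here bears on VP versus VNP.
References: [BurgisserIkenmeyer2017] Prop. 2.8, Cor. 2.9 (power sums), Def. 3.3.
-/

set_option linter.dupNamespace false

noncomputable section

namespace Summit.ValiantsHypothesis.ValiantsHypothesis.Theorems.GeneratorObstructions.PerGenDegreeSuperQP

open MvPolynomial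
open Literature.NumberTheory.DiophantineGeometry Literature.Computability.AlgebraicComplexity
  Literature.Computability.Complexity

section Binary

variable {m : ℕ}

/-- `y^m + w^m` as a sum of two monomials. [folklore] -/
theorem binaryFermat_eq (m : ℕ) :
    ((X 0) ^ m + (X 1) ^ m : MvPolynomial (Fin 2) ℂ) =
      monomial (Finsupp.single 0 m) 1 + monomial (Finsupp.single 1 m) 1 := by
  rw [X_pow_eq_monomial, X_pow_eq_monomial]

/-- The two exponents differ (`m ≥ 1`). [folklore] -/
theorem binaryFermat_exp_ne (hm : 0 < m) :
    (Finsupp.single (0 : Fin 2) m : Fin 2 →₀ ℕ) ≠ Finsupp.single 1 m := by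
  intro h
  have := congrArg (fun e => e 0) h
  simp at this
  omega

/-- The support of `y^m + w^m` (`m ≥ 1`). [folklore] -/
theorem support_binaryFermat (hm : 0 < m) :
    ((X 0) ^ m + (X 1) ^ m : MvPolynomial (Fin 2) ℂ).support =
      {(Finsupp.single (0 : Fin 2) m : Fin 2 →₀ ℕ), Finsupp.single 1 m} := by
  classical
  have hne := binaryFermat_exp_ne hm
  ext α
  rw [binaryFermat_eq, mem_support_iff, coeff_add, coeff_monomial, coeff_monomial, Finset.mem_insert,
    Finset.mem_singleton]
  by_cases h1 : (Finsupp.single (0 : Fin 2) m : Fin 2 →₀ ℕ) = α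
  · subst h1; rw [if_pos rfl, if_neg hne.symm]; simp
  · by_cases h2 : (Finsupp.single (1 : Fin 2) m : Fin 2 →₀ ℕ) = α
    · subst h2; rw [if_neg h1, if_pos rfl]; simp
    · simp only [if_neg h1, if_neg h2, add_zero, ne_eq, not_true_eq_false, false_iff, not_or]
      exact ⟨Ne.symm h1, Ne.symm h2⟩

/-- `y^m + w^m` is a form of degree `m`. [folklore] -/
theorem binaryFermat_isHomogeneous (m : ℕ) :
    ((X 0) ^ m + (X 1) ^ m : MvPolynomial (Fin 2) ℂ).IsHomogeneous m := by
  refine IsHomogeneous.add ?_ ?_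
  · simpa using (isHomogeneous_X ℂ (0 : Fin 2)).pow m
  · simpa using (isHomogeneous_X ℂ (1 : Fin 2)).pow m

/-- `y^m + w^m ≠ 0` (`m ≥ 1`). [folklore] -/
theorem binaryFermat_ne_zero (hm : 0 < m) : ((X 0) ^ m + (X 1) ^ m : MvPolynomial (Fin 2) ℂ) ≠ 0 := by
  intro h
  have := support_binaryFermat hm
  rw [h, support_zero] at this
  exact absurd (this ▸ Finset.mem_insert_self _ _) (Finset.notMem_empty _)

/-- **`y^m + w^m` is polystable** (`m ≥ 2`): separating stabilizer `(ζ, 1)` with `ζ` a primitive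
`m`-th root of unity; positive cone `(1,1) = (1/m)(m,0) + (1/m)(0,m)`.
[cite: BurgisserIkenmeyer2017, Prop. 2.8 and Cor. 2.9] -/
theorem isPolystable_binaryFermat (hm : 2 ≤ m) :
    IsPolystable ((X 0) ^ m + (X 1) ^ m : MvPolynomial (Fin 2) ℂ) := by
  classical
  have hm0 : m ≠ 0 := by omega
  have hζ := Complex.isPrimitiveRoot_exp m hm0
  set ζ : ℂ := Complex.exp (2 * Real.pi * Complex.I / m) with hζdef
  have hζ1 : ζ ≠ 1 := hζ.ne_one (by omega)
  refine isPolystable_of_separating_diagonalStabilizers _ (binaryFermat_isHomogeneous m) ?_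
    (fun _ => 1 / (m : ℚ)) ?_ ?_
  · intro a b hab
    refine ⟨fun x => if x = 0 then ζ else 1, ?_, ?_⟩
    · rw [binaryFermat_eq, map_add, linSubst_diagonal_monomial, linSubst_diagonal_monomial,
        Finsupp.prod_single_index (h := fun x n => (if x = (0 : Fin 2) then ζ else 1) ^ n) (pow_zero _),
        Finsupp.prod_single_index (h := fun x n => (if x = (0 : Fin 2) then ζ else 1) ^ n) (pow_zero _)]
      simp [hζ.pow_eq_one]
    · have hζ1' : (1 : ℂ) ≠ ζ := fun h => hζ1 h.symm
      fin_cases a <;> fin_cases b <;> simp_all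
  · intro α _
    have : (0 : ℚ) < m := by exact_mod_cast Nat.pos_of_ne_zero hm0
    positivity
  · intro i
    rw [support_binaryFermat (by omega), Finset.sum_pair (binaryFermat_exp_ne (by omega))]
    have hmq : (m : ℚ) ≠ 0 := by exact_mod_cast hm0
    fin_cases i <;> simp <;> field_simp

/-- **`y^m + w^m = per_m(y·1 + w·C)` is a 2-variable degeneration of `per_m`** (`m ≥ 2`), placed
with `y ↦ x₀₀`, `w ↦ x₀₁`. [cite: MulmuleySohoni2001, §4] -/
theorem binaryFermat_mem_orbitClosure_per (hm : 2 ≤ m) :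
    haveI : NeZero m := ⟨by omega⟩
    MvPolynomial.rename (fun i : Fin 2 => (toLex ((0 : Fin m), (Fin.castLE hm i)) : MatIdx m))
        ((X 0) ^ m + (X 1) ^ m : MvPolynomial (Fin 2) ℂ) ∈
      orbitClosure (MvPolynomial.rename (toLex : Fin m × Fin m → MatIdx m) (perPoly (Fin m) ℂ)) := by
  haveI : NeZero m := ⟨by omega⟩
  haveI : Infinite ℂ := CharZero.infinite ℂ
  obtain ⟨A, hA⟩ := exists_linSubst_cycleDiag_labels hm
    (fun _ => (toLex ((0 : Fin m), Fin.castLE hm 0) : MatIdx m))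
    (fun _ => (toLex ((0 : Fin m), Fin.castLE hm 1) : MatIdx m))
  have hexp := linSubst_cycleDiag_labels_perFormLex hm _ _ hA
  rw [Finset.prod_const, Finset.prod_const, Finset.card_univ, Fintype.card_fin] at hexp
  have hq : MvPolynomial.rename (fun i : Fin 2 => (toLex ((0 : Fin m), (Fin.castLE hm i)) : MatIdx m))
        ((X 0) ^ m + (X 1) ^ m : MvPolynomial (Fin 2) ℂ) =
      X (toLex ((0 : Fin m), Fin.castLE hm 0) : MatIdx m) ^ m +
        X (toLex ((0 : Fin m), Fin.castLE hm 1) : MatIdx m) ^ m := by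
    simp [map_add, map_pow, rename_X]
  rw [hq, ← hexp]
  exact endOrbit_subset_orbitClosure_holds (k := ℂ) (σ := MatIdx m) _ ⟨A, rfl⟩

/-- **The ray `j = 2` of `S(per_m)` is hit** (`m ≥ 2`): `(k²)^*` occurs in `ℂ[Δ_m[per_m]]` for some
`k ≥ 1`, via the polystable binary degeneration `y^m + w^m`. [cite: BurgisserIkenmeyer2017, Prop. 2.8 and Def. 3.3] -/
theorem per_ray_two_hit (hm : 2 ≤ m) :
    ∃ k : ℕ, 0 < k ∧
      highestWeightSpace (orbitCoordRep (MvPolynomial.rename toLex (perPoly (Fin m) ℂ)) m)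
        (partitionWeightLex m (Nat.Partition.rectangle 2 k)) ≠ ⊥ := by
  haveI : NeZero m := ⟨by omega⟩
  have hκ : Function.Injective (fun i : Fin 2 => (toLex ((0 : Fin m), (Fin.castLE hm i)) : MatIdx m)) := by
    intro i i' h
    have := congrArg (fun z : MatIdx m => (ofLex z).2) h
    simp only [ofLex_toLex] at this
    exact Fin.castLE_injective hm this
  obtain ⟨k, hk, hocc⟩ := exists_hasHighestWeight_rectangle_of_isSLSemistable_projection
    (matIdxEquiv m) (show m ≠ 0 by omega) (perFormLex_isHomogeneous m) (show 0 < 2 by omega) _ hκ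
    (binaryFermat_isHomogeneous m) (binaryFermat_mem_orbitClosure_per hm)
    ((isPolystable_binaryFermat hm).isSLSemistable (binaryFermat_ne_zero (by omega)))
  exact ⟨k, hk, hocc⟩

/-- **The ray `j = 2` carries an atom** (`m ≥ 2`). [cite: BurgisserIkenmeyer2017, Prop. 2.8 and Def. 3.3] -/
theorem per_exists_ray_atom_two (hm : 2 ≤ m) :
    ∃ k₀ : ℕ, 0 < k₀ ∧
      highestWeightSpace (orbitCoordRep (MvPolynomial.rename toLex (perPoly (Fin m) ℂ)) m)
        (partitionWeightLex m (Nat.Partition.rectangle 2 k₀)) ≠ ⊥ ∧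
      (∀ k : ℕ, 0 < k → k < k₀ →
        highestWeightSpace (orbitCoordRep (MvPolynomial.rename toLex (perPoly (Fin m) ℂ)) m)
          (partitionWeightLex m (Nat.Partition.rectangle 2 k)) = ⊥) ∧
      (∀ χ₁ χ₂ : Weight (MatIdx m), χ₁ + χ₂ = partitionWeightLex m (Nat.Partition.rectangle 2 k₀) →
        χ₁ ≠ 0 → χ₂ ≠ 0 →
        highestWeightSpace (orbitCoordRep (MvPolynomial.rename toLex (perPoly (Fin m) ℂ)) m) χ₁ = ⊥ ∨
          highestWeightSpace (orbitCoordRep (MvPolynomial.rename toLex (perPoly (Fin m) ℂ)) m) χ₂ = ⊥) :=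
  exists_least_rectangle_atom _ _ (by omega) (by nlinarith) (per_ray_two_hit hm)

end Binary

end Summit.ValiantsHypothesis.ValiantsHypothesis.Theorems.GeneratorObstructions.PerGenDegreeSuperQP

end
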